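import Summits.BirchSwinnertonDyer.Rank1Residual.Additive.RamifiedOrdinaryLineKummerKernel
import Summits.BirchSwinnertonDyer.Rank1Residual.Additive.RamifiedOrdinaryLineInertiaScalars
import HarnessLib

/-!
# An ORDINARY point on the Kummer–Deuring good model forces `e ∣ p − 1`; on the `(t′)` cell of O5
# (`e ∤ p − 1`) every `p`-torsion point of the good model reduces to `Õ` (row T-CG-SS addendum A1,
# cell `b2b-bsdres`, team n1011; seat n1011-p05 GEN 7)

HONEST FRAMING (cell `b2b-bsdres`, run/shared/lean/b2b/bsd-rank1-residual/, verbatim in every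
file): the goal of the cell is to DELETE the COMBINATION-SHAPED residual classes of the
Birch–Swinnerton-Dyer formula for ALL analytic-rank `≤ 1` elliptic curves over `ℚ` — "full BSD
formula for every rank `≤ 1` curve in class `C`" assembled STRICTLY from published theorems — so
that the rank-`≤ 1` remainder becomes exactly the CONSTRUCTION-SHAPED classes, which are TYPED
(missing-input `Prop`s), NOT attempted. This is not "finishing BSD". Team n1011 / class O5: research
route; TOOL theorems, ALL UNCONDITIONAL (no named fact enters); no definition; nothing booked; no
label changes.

## What (`E/ℚ` globally minimal, `p ≥ 5`, `v ∋ p`, potentially good: `ord_p j ≥ 0`, bad at `v`,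
## `e = semistabilityIndex W p`, `m' = ord_pΔ_min / gcd(12, ord_pΔ_min)`, `θ^e = p`, and a good
## model `W₀ = C • E ⊗ K̄_v` of KUMMER SHAPE `C = ⟨θ^{m'}, 0, 0, 0⟩ · C_s`, `C_s` rational —
## the output shape of p07's `exists_goodModel_of_kummerElement`)

* §1 `exists_isRamifiedOrdinaryLine_and_forall_iff_smul_eq_of_ordinary` — p07's F3a
  `RamifiedOrdinaryLineKummerKernel.exists_isRamifiedOrdinaryLine_and_forall_iff_smul_eq` with the
  ORDINARY POINT (`hord`: some `p`-torsion point of `W₀` has non-zero reduction) as a HYPOTHESIS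
  instead of `e ∣ p − 1` (which F3a uses only to produce `hord` from the residues of `c₄`/`c₆`):
  there is a ramified ordinary line `Lv` whose quotient character has KERNEL the fixing group of
  `θ` and on whose quotient inertial elements act trivially or FREELY (K3).
* §2 **`semistabilityIndex_dvd_sub_one_of_ordinary`** — under the same hypotheses `e ∣ p − 1`:
  take `σ ∈ I_v` with `σθ = ζθ`, `ζ` a PRIMITIVE `e`-th root (Kummer surjectivity,
  `exists_mem_absInertia_smul_eq_primitiveRoot_mul`); `σ` acts on the `𝔽_p`-line
  `(E[p^∞]/C)[p]` by a scalar `b` (cc-typer-2's S3 tools `exists_quotGenerator`/`exists_quotScalar`);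
  `b^e = 1` (`σ^e` fixes `θ`), `b^d ≠ 1` for `0 < d < e` (freeness: `σ^d` would fix `θ`, `ζ^d = 1`);
  so `b̄ ∈ (ℤ/p)ˣ` has order EXACTLY `e`, and `e ∣ #(ℤ/p)ˣ = p − 1`. (Serre–Tate 1968 §2 Cor. 2:
  inertia of the field of good reduction acts faithfully on the special fibre; an automorphism of
  an ORDINARY curve acts on `Ẽ[p]` by a root of unity of the same order, Serre 1972 §5.6.)
* §3 `forall_torsion_goodReductionHom_eq_zero_of_not_dvd` — contrapositive: if `e ∤ p − 1` (the
  census cell `(t′)` = `SubTprime`), EVERY `p`-torsion point of `W₀(K̄_v)` reduces to `Õ`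
  (`W̃₀` has no `p`-torsion coming from `E[p]`: the reduction is SUPERSINGULAR in this sense), and the
  class form `SubTprime.exists_goodModel_forall_torsion_red_eq_zero` (the Kummer–Deuring model of a
  `(t′)` curve). This is the kernel certificate behind the O5 typing's sentence "(t′): `e ∤ p − 1`
  (so `e ∣ p + 1`: potentially good SUPERSINGULAR over the tame semistabilising field)"
  (`Additive/SharpenedStatements.lean`, `SubTprime`). What it does NOT give (located gap for the
  `(t′)` half of Greenberg's Thm. 1.7, row T-CG-SS): that every `p^k`-torsion point reduces to `Õ`
  — this needs `W̃₀(k̄)[p] = 0`, i.e. a lift of residual `p`-torsion, i.e. `p`-divisibility of the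
  kernel of reduction `Ŵ₀(𝔪̄)` over `K̄_v`, not in the tree.

References: J.-P. Serre, J. Tate, Ann. of Math. 88 (1968) §2 Thm. 2, Cor. 2 [SerreTate1968];
J.-P. Serre, Invent. Math. 15 (1972) §1.3, §5.6 (p. 312) [Serre1972]; J. H. Silverman, *AEC* VII.5.5,
III.10 [SilvermanAEC2009]; rows T-ROL-ORD (p07), T-ROL-G K3 (p05), S3 tools (cc-typer-2).
-/

set_option autoImplicit false

noncomputable section

open scoped Classical NNReal NumberField Valued

open WeierstrassCurve

namespace Summit.BirchSwinnertonDyer.Rank1Residual.Additive.GoodModelLine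

open NumberField IsDedekindDomain Field IsDedekindDomain.HeightOneSpectrum
  Literature.NumberTheory.GaloisRepresentations Literature.NumberTheory.EllipticCurves
  Literature.NumberTheory.EllipticCurves.GreenbergSelmer
  Literature.NumberTheory.EllipticCurves.EmertonPollackWeston2006
  Literature.NumberTheory.EllipticCurves.Rank1Residual
  Literature.NumberTheory.EllipticCurves.Rank1Residual.Typed
  Summit.BirchSwinnertonDyer.Rank1Residual.X2.GreenbergVatsalReductionDatum
  Summit.BirchSwinnertonDyer.Rank1Residual.Additive.RamifiedOrdinaryLineInertiaScalars

variable (W : WeierstrassCurve ℚ) [W.IsElliptic] [W.IsGloballyMinimal] (p : ℕ) [hp : Fact p.Prime]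
  {v : HeightOneSpectrum (𝓞 ℚ)}

/-! ## §1 The ramified ordinary line of a Kummer-shaped good model WITH AN ORDINARY POINT -/

omit [W.IsElliptic] in
/-- **`ψ` fixes `θ^{m'}` iff it fixes `θ`**, for `θ^e = p` and `gcd(e, m') = 1`: the quotient
`ψθ/θ` is an `e`-th root of unity, and an `e`-th root of unity whose `m'`-th power is `1` is `1`.
(The step of p07's F3a relating the Kummer element `u = θ^{m'}` of the model to `θ`.) [folklore] -/
theorem algEquiv_apply_pow_eq_iff_apply_eq {θ : AlgebraicClosure (v.adicCompletion ℚ)}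
    (hθ : θ ^ semistabilityIndex W p = ((p : ℕ) : AlgebraicClosure (v.adicCompletion ℚ)))
    {m' : ℕ} (hcop : Nat.Coprime (semistabilityIndex W p) m')
    (ψ : AlgebraicClosure (v.adicCompletion ℚ) ≃ₐ[v.adicCompletion ℚ]
      AlgebraicClosure (v.adicCompletion ℚ)) :
    ψ (θ ^ m') = θ ^ m' ↔ ψ θ = θ := by
  let L := AlgebraicClosure (v.adicCompletion ℚ)
  haveI : CharZero L := charZero_of_injective_algebraMap (algebraMap ℚ L).injective
  have he0 : semistabilityIndex W p ≠ 0 := semistabilityIndex_ne_zero p W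
  have hp0 : ((p : ℕ) : L) ≠ 0 := Nat.cast_ne_zero.mpr hp.out.ne_zero
  have hθ0 : θ ≠ 0 := fun h ↦ by
    rw [h, zero_pow he0] at hθ; exact hp0 hθ.symm
  constructor
  · intro h
    set ζ : L := ψ θ * θ⁻¹ with hζ
    have hψθ : ψ θ = ζ * θ := by rw [hζ, inv_mul_cancel_right₀ hθ0]
    have hζe : ζ ^ semistabilityIndex W p = 1 := by
      rw [hζ, mul_pow, ← map_pow, hθ, map_natCast, inv_pow, hθ, mul_inv_cancel₀ hp0]
    have hζm : ζ ^ m' = 1 := by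
      rw [hζ, mul_pow, ← map_pow, h, inv_pow, mul_inv_cancel₀ (pow_ne_zero m' hθ0)]
    have hζ1 : ζ = 1 := by
      have hg : ζ ^ ((semistabilityIndex W p).gcd m') = 1 := pow_gcd_eq_one.mpr ⟨hζe, hζm⟩
      rwa [Nat.Coprime.gcd_eq_one hcop, pow_one] at hg
    rw [hψθ, hζ1, one_mul]
  · intro h
    rw [map_pow, h]


set_option maxHeartbeats 400000 in -- `hred` by `rfl` through three transports (as in F3a)
/-- **p07's F3a with the ordinary point as a hypothesis.** For `E/ℚ` globally minimal, `p ≥ 5`,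
`v ∋ p`, bad at `v`, `θ^e = p`, and a good model `W₀ = C • E ⊗ K̄_v` with `C = ⟨θ^{m'}, 0, 0, 0⟩ · C_s`
(`C_s` rational) possessing an ORDINARY `p`-torsion point: a ramified ordinary line `Lv` with
(i) `σ` trivial on `E[p^∞]/Lv⁺ ↔ σθ = θ` for inertial `σ`, (ii) freeness. The named steps are
consumed BY NAME (F-A2 `exists_localDatum_mem_iff_red_eq_zero`, p07's
`KummerModelInertiaScaling.forall_smul_sub_mem_plus_iff_smul_eq`, F-A3
`isRamifiedOrdinaryLine_of_goodModel`, K3 `smul_sub_mem_plus_of_smul_sub_mem_plus`,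
`algEquiv_apply_pow_eq_iff_apply_eq`); only the reduction-map boilerplate `red = red_{W₀} ∘ Φ_C` is
restated (as in F-A3 / B §2 / F3a). [cite: SerreTate1968, §2 Thm. 2 and Cor. 2] [cite: Serre1972, §5.6 (p. 312)] -/
theorem exists_isRamifiedOrdinaryLine_and_forall_iff_smul_eq_of_ordinary (hp5 : 5 ≤ p)
    (hpv : ((p : ℕ) : 𝓞 ℚ) ∈ v.asIdeal) (hbad : ¬ W.HasGoodReductionAt v)
    {θ : AlgebraicClosure (v.adicCompletion ℚ)}
    (hθ : θ ^ semistabilityIndex W p = ((p : ℕ) : AlgebraicClosure (v.adicCompletion ℚ)))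
    {C : VariableChange (AlgebraicClosure (v.adicCompletion ℚ))}
    {W₀ : WeierstrassCurve (specVal v).integer}
    (hW₀ : C • (W.baseChange (v.adicCompletion ℚ)).baseChange (AlgebraicClosure (v.adicCompletion ℚ)) =
      W₀.baseChange (AlgebraicClosure (v.adicCompletion ℚ)))
    (hΔ : IsUnit W₀.Δ)
    (hu0 : θ ^ (padicValInt p W.minimalDiscriminantInt /
      Nat.gcd 12 (padicValInt p W.minimalDiscriminantInt)) ≠ 0)
    (Cs : VariableChange ℚ)
    (hC : C = ⟨Units.mk0 _ hu0, 0, 0, 0⟩ *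
      Cs.map (algebraMap ℚ (AlgebraicClosure (v.adicCompletion ℚ))))
    (hord : ∃ P : (W₀.baseChange (AlgebraicClosure (v.adicCompletion ℚ))).toAffine.Point,
      (p : ℤ) • P = 0 ∧ goodReductionHom W₀ (Valuation.integer.integers (specVal v)) hΔ P ≠ 0) :
    ∃ Lv : LocalDatum ℚ (W.geomPrimaryTorsion p) v, IsRamifiedOrdinaryLine W p Lv ∧
      (∀ σ ∈ absInertia (v.adicCompletion ℚ),
        ((∀ m : W.geomPrimaryTorsion p,
            absGaloisRestrict ℚ (v.adicCompletion ℚ) σ • m - m ∈ Lv.plus) ↔ σ • θ = θ)) ∧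
      (∀ τ ∈ absInertia (v.adicCompletion ℚ), ∀ m : W.geomPrimaryTorsion p, m ∉ Lv.plus →
        absGaloisRestrict ℚ (v.adicCompletion ℚ) τ • m - m ∈ Lv.plus → τ • θ = θ) := by
  let L := AlgebraicClosure (v.adicCompletion ℚ)
  haveI : CharZero L := charZero_of_injective_algebraMap (algebraMap ℚ L).injective
  set e : ℕ := semistabilityIndex W p with hedef
  set m' : ℕ := padicValInt p W.minimalDiscriminantInt /
    Nat.gcd 12 (padicValInt p W.minimalDiscriminantInt) with hm'
  have he0 : e ≠ 0 := semistabilityIndex_ne_zero p W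
  have hpe : ¬ p ∣ e := not_dvd_semistabilityIndex p W hp5
  have hcop : Nat.Coprime e m' := coprime_semistabilityIndex_div_gcd p W
  have hu : (θ ^ m') ^ semistabilityIndex W p = ((p : ℕ) : L) ^ m' := by
    rw [← pow_mul, mul_comm, pow_mul, hθ]
  haveI := charP_residueField_specVal p hpv
  -- the datum with its reduction map (as in F-A3 / B §2 / F3a)
  let Φ₁ : localPoints W (v.adicCompletion ℚ) ≃+
      ((W.baseChange (v.adicCompletion ℚ)).baseChange (AlgebraicClosure (v.adicCompletion ℚ))).toAffine.Point :=
    Affine.Point.congrEquiv (baseChange_baseChange_adicCompletion W v).symm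
  let Φ : localPoints W (v.adicCompletion ℚ) ≃+
      (W₀.baseChange (AlgebraicClosure (v.adicCompletion ℚ))).toAffine.Point :=
    (Φ₁.trans (VariableChange.pointEquiv _ C)).trans (Affine.Point.congrEquiv hW₀)
  let red : localPoints W (v.adicCompletion ℚ) →+
      (W₀.map (IsLocalRing.residue (specVal v).integer)).toAffine.Point :=
    (goodReductionHom W₀ (Valuation.integer.integers (specVal v)) hΔ).comp Φ.toAddMonoidHom
  have hred : ∀ P, red P = goodReductionHom W₀ (Valuation.integer.integers (specVal v)) hΔ
      (Affine.Point.congrEquiv hW₀ (VariableChange.pointEquiv _ C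
        (Affine.Point.congrEquiv (baseChange_baseChange_adicCompletion W v).symm P))) := fun _ ↦ rfl
  obtain ⟨Lv, hLv⟩ := exists_localDatum_mem_iff_red_eq_zero W p hW₀ hΔ red hred
  -- (i) the kernel of the quotient character
  have hiff : ∀ σ ∈ absInertia (v.adicCompletion ℚ),
      ((∀ m : W.geomPrimaryTorsion p,
          absGaloisRestrict ℚ (v.adicCompletion ℚ) σ • m - m ∈ Lv.plus) ↔ σ • θ = θ) := by
    intro σ hσ
    set ψ : L ≃ₐ[v.adicCompletion ℚ] L := absoluteGaloisGroup.toAlgEquiv _ σ with hψ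
    have hσue : σ • ((θ ^ m') ^ semistabilityIndex W p) = (θ ^ m') ^ semistabilityIndex W p := by
      change ψ ((θ ^ m') ^ semistabilityIndex W p) = _
      rw [hu, map_pow, map_natCast]
    rw [forall_smul_sub_mem_plus_iff_smul_eq W p hW₀ hΔ red hred hord Lv hLv hpv hu0 Cs hC he0 hpe
      hσ hσue]
    exact algEquiv_apply_pow_eq_iff_apply_eq W p hθ hcop ψ
  refine ⟨Lv, isRamifiedOrdinaryLine_of_goodModel W p hW₀ hΔ red hred hord Lv hLv hpv hbad, hiff,
    fun τ hτ m hm hτm ↦ ?_⟩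
  -- (ii) freeness: K3's dichotomy
  exact (hiff τ hτ).1
    (smul_sub_mem_plus_of_smul_sub_mem_plus W p hW₀ hΔ red hred Lv hLv hp5 hτ hm hτm)

/-! ## §2 An ordinary point forces `e ∣ p − 1` -/

omit [W.IsElliptic] [W.IsGloballyMinimal] hp in
/-- Powers of a scalar on the quotient: if `σ x ≡ b x (mod C)` then `σ^d x ≡ b^d x (mod C)`
(`C` is `D_v`-stable). [folklore] -/
theorem pow_smul_sub_pow_nsmul_mem_plus (Lv : LocalDatum ℚ (W.geomPrimaryTorsion p) v)
    (σ : absoluteGaloisGroup (v.adicCompletion ℚ)) {x : W.geomPrimaryTorsion p} {b : ℕ}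
    (hb : absGaloisRestrict ℚ (v.adicCompletion ℚ) σ • x - b • x ∈ Lv.plus) (d : ℕ) :
    (absGaloisRestrict ℚ (v.adicCompletion ℚ) σ) ^ d • x - b ^ d • x ∈ Lv.plus := by
  induction d with
  | zero => rw [pow_zero, one_smul, pow_zero, one_smul, sub_self]; exact zero_mem _
  | succ d ih =>
    -- `σ^{d+1} x - b^{d+1} x = σ (σ^d x - b^d x) + b^d (σ x - b x)`
    have h1 : absGaloisRestrict ℚ (v.adicCompletion ℚ) σ •
        ((absGaloisRestrict ℚ (v.adicCompletion ℚ) σ) ^ d • x - b ^ d • x) ∈ Lv.plus :=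
      Lv.smul_mem σ ih
    have h2 : b ^ d • (absGaloisRestrict ℚ (v.adicCompletion ℚ) σ • x - b • x) ∈ Lv.plus :=
      AddSubgroup.nsmul_mem _ hb _
    have e1 : (absGaloisRestrict ℚ (v.adicCompletion ℚ) σ) ^ (d + 1) • x - b ^ (d + 1) • x =
        absGaloisRestrict ℚ (v.adicCompletion ℚ) σ •
          ((absGaloisRestrict ℚ (v.adicCompletion ℚ) σ) ^ d • x - b ^ d • x) +
        b ^ d • (absGaloisRestrict ℚ (v.adicCompletion ℚ) σ • x - b • x) := by
      rw [pow_succ', mul_smul, pow_succ, mul_smul, smul_sub, smul_sub,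
        smul_comm (absGaloisRestrict ℚ (v.adicCompletion ℚ) σ) (b ^ d) x]
      abel
    rw [e1]
    exact add_mem h1 h2

/-- **An ORDINARY point on the Kummer–Deuring good model forces `e ∣ p − 1`** (`p ≥ 5`; hence, by
additive-p2's `typeG_iff_not_subM_and_semistabilityIndex_dvd`, Delbourgo's hypothesis (G)). The
quotient character of the ramified ordinary line of §1 takes, at a Kummer generator `σ`
(`σθ = ζθ`, `ζ` primitive), a value `b̄ ∈ (ℤ/p)ˣ` of order EXACTLY `e` (`b̄^e = 1` because `σ^e`
fixes `θ`; `b̄^d ≠ 1` for `0 < d < e` by freeness), and the order of a unit of `ℤ/p` divides `p − 1`.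
Serre 1972 §5.6 (`p ≥ 5`: the image `Φ_p` of inertia is cyclic of order `e`; for potentially
ORDINARY reduction it embeds in the automorphisms of the étale quotient `≅ ℤ_pˣ`, so `e ∣ p − 1`);
Serre–Tate 1968 §2 Cor. 2. [cite: Serre1972, §5.6 (p. 312) and §1.3] [cite: SerreTate1968, §2 Thm. 2 and Cor. 2] -/
theorem semistabilityIndex_dvd_sub_one_of_ordinary (hp5 : 5 ≤ p)
    (hpv : ((p : ℕ) : 𝓞 ℚ) ∈ v.asIdeal) (hbad : ¬ W.HasGoodReductionAt v)
    {θ : AlgebraicClosure (v.adicCompletion ℚ)}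
    (hθ : θ ^ semistabilityIndex W p = ((p : ℕ) : AlgebraicClosure (v.adicCompletion ℚ)))
    {C : VariableChange (AlgebraicClosure (v.adicCompletion ℚ))}
    {W₀ : WeierstrassCurve (specVal v).integer}
    (hW₀ : C • (W.baseChange (v.adicCompletion ℚ)).baseChange (AlgebraicClosure (v.adicCompletion ℚ)) =
      W₀.baseChange (AlgebraicClosure (v.adicCompletion ℚ)))
    (hΔ : IsUnit W₀.Δ)
    (hu0 : θ ^ (padicValInt p W.minimalDiscriminantInt /
      Nat.gcd 12 (padicValInt p W.minimalDiscriminantInt)) ≠ 0)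
    (Cs : VariableChange ℚ)
    (hC : C = ⟨Units.mk0 _ hu0, 0, 0, 0⟩ *
      Cs.map (algebraMap ℚ (AlgebraicClosure (v.adicCompletion ℚ))))
    (hord : ∃ P : (W₀.baseChange (AlgebraicClosure (v.adicCompletion ℚ))).toAffine.Point,
      (p : ℤ) • P = 0 ∧ goodReductionHom W₀ (Valuation.integer.integers (specVal v)) hΔ P ≠ 0) :
    semistabilityIndex W p ∣ p - 1 := by
  let L := AlgebraicClosure (v.adicCompletion ℚ)
  haveI : CharZero L := charZero_of_injective_algebraMap (algebraMap ℚ L).injective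
  have he0 : semistabilityIndex W p ≠ 0 := semistabilityIndex_ne_zero p W
  have hpe : ¬ p ∣ semistabilityIndex W p := not_dvd_semistabilityIndex p W hp5
  have hp0 : ((p : ℕ) : L) ≠ 0 := Nat.cast_ne_zero.mpr hp.out.ne_zero
  have hθ0 : θ ≠ 0 := fun h ↦ by
    rw [h, zero_pow he0] at hθ; exact hp0 hθ.symm
  obtain ⟨Lv, hL, hiff, hfree⟩ := exists_isRamifiedOrdinaryLine_and_forall_iff_smul_eq_of_ordinary
    W p hp5 hpv hbad hθ hW₀ hΔ hu0 Cs hC hord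
  -- a Kummer generator `σ`: `σ θ = ζ θ`, `ζ` primitive, fixed by inertia
  obtain ⟨ζ, hζ, σ, hσ, hσθ⟩ := exists_mem_absInertia_smul_eq_primitiveRoot_mul W p hpv hθ
  have hσζ : σ • ζ = ζ := smul_eq_self_of_pow_eq_one p hpv he0 hpe hζ.pow_eq_one hσ
  set g := absGaloisRestrict ℚ (v.adicCompletion ℚ) σ with hg
  -- `σ^e` acts trivially on the quotient
  have hσe : ∀ m : W.geomPrimaryTorsion p, g ^ semistabilityIndex W p • m - m ∈ Lv.plus := by
    have hfix : (σ ^ semistabilityIndex W p) • θ = θ := by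
      rw [pow_smul_eq_pow_mul hσθ hσζ, hζ.pow_eq_one, one_mul]
    have h := (hiff _ (Subgroup.pow_mem _ hσ _)).2 hfix
    rw [map_pow] at h
    exact h
  -- the scalar `b` of `σ` on `(E[p^∞]/C)[p]`
  obtain ⟨x, hx0, hxp, hgen⟩ := exists_quotGenerator hL
  obtain ⟨b, hb, -⟩ := exists_quotScalar σ hxp hgen
  have hbe : ((b : ZMod p)) ^ semistabilityIndex W p = 1 := quotScalar_pow_eq_one σ hσe hx0 hxp hb
  -- `σ x ≡ b x (mod C)`
  have hbx : g • x - b • x ∈ Lv.plus := by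
    rw [← Lv.ker_grMk, AddMonoidHom.mem_ker, map_sub, map_nsmul, hb, sub_self]
  have hxC : x ∉ Lv.plus := fun h ↦ hx0 (by rwa [← Lv.ker_grMk, AddMonoidHom.mem_ker] at h)
  -- `b^d ≠ 1 (mod p)` for `0 < d < e`
  have hne : ∀ d : ℕ, 0 < d → d < semistabilityIndex W p → ((b : ZMod p)) ^ d ≠ 1 := by
    intro d hd0 hde hbd
    -- then `σ^d x ≡ x (mod C)` …
    have h1 : g ^ d • x - b ^ d • x ∈ Lv.plus := pow_smul_sub_pow_nsmul_mem_plus W p Lv σ hbx d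
    have h2 : b ^ d • x - x ∈ Lv.plus := by
      rw [← Lv.ker_grMk, AddMonoidHom.mem_ker, map_sub, map_nsmul]
      have hmod : (b ^ d) % p = 1 := by
        have h := (ZMod.natCast_eq_natCast_iff' (b ^ d) 1 p).1 (by rw [Nat.cast_pow, hbd, Nat.cast_one])
        rwa [Nat.mod_eq_of_lt hp.out.one_lt] at h
      rw [← Nat.div_add_mod (b ^ d) p, hmod, add_smul, one_smul, mul_comm, mul_smul, hxp, smul_zero,
        zero_add, sub_self]
    have h3 : g ^ d • x - x ∈ Lv.plus := by
      have := add_mem h1 h2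
      rwa [sub_add_sub_cancel] at this
    -- … so freeness makes `σ^d` fix `θ`: `ζ^d = 1`
    have hfix : (σ ^ d) • θ = θ := by
      refine hfree _ (Subgroup.pow_mem _ hσ _) x hxC ?_
      rw [map_pow]
      exact h3
    rw [pow_smul_eq_pow_mul hσθ hσζ d] at hfix
    have hζd : ζ ^ d = 1 := mul_right_cancel₀ hθ0 (hfix.trans (one_mul θ).symm)
    exact hζ.pow_ne_one_of_pos_of_lt hd0.ne' hde hζd
  -- the unit `b̄` has order exactly `e`, which divides `#(ℤ/p)ˣ = p − 1`
  have hunit : IsUnit ((b : ZMod p)) := IsUnit.of_pow_eq_one hbe he0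
  set u : (ZMod p)ˣ := hunit.unit with hu
  have horder : orderOf u = semistabilityIndex W p := by
    rw [← orderOf_units, IsUnit.unit_spec]
    refine (orderOf_eq_iff (Nat.pos_of_ne_zero he0)).2 ⟨hbe, fun d hde hd0 ↦ hne d hd0 hde⟩
  rw [← horder, ← ZMod.card_units p, ← Nat.card_eq_fintype_card]
  exact orderOf_dvd_natCard u

/-! ## §3 The `(t′)` cell: every `p`-torsion point of the Kummer–Deuring model reduces to `Õ` -/

/-- **`e ∤ p − 1` ⇒ NO ordinary point**: on a Kummer-shaped good model of an additive potentially good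
`E/ℚ` at `p ≥ 5` with `e ∤ p − 1`, every `p`-torsion point of `W₀(K̄_v)` reduces to `Õ` — the
reduction `W̃₀` receives no `p`-torsion from `E[p]` (potentially SUPERSINGULAR reduction, in this
sense). Contrapositive of `semistabilityIndex_dvd_sub_one_of_ordinary`.
[cite: Serre1972, §5.6 (p. 312)] [cite: SerreTate1968, §2 Cor. 2] -/
theorem forall_torsion_goodReductionHom_eq_zero_of_not_dvd (hp5 : 5 ≤ p)
    (hpv : ((p : ℕ) : 𝓞 ℚ) ∈ v.asIdeal) (hbad : ¬ W.HasGoodReductionAt v)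
    (hndvd : ¬ semistabilityIndex W p ∣ p - 1)
    {θ : AlgebraicClosure (v.adicCompletion ℚ)}
    (hθ : θ ^ semistabilityIndex W p = ((p : ℕ) : AlgebraicClosure (v.adicCompletion ℚ)))
    {C : VariableChange (AlgebraicClosure (v.adicCompletion ℚ))}
    {W₀ : WeierstrassCurve (specVal v).integer}
    (hW₀ : C • (W.baseChange (v.adicCompletion ℚ)).baseChange (AlgebraicClosure (v.adicCompletion ℚ)) =
      W₀.baseChange (AlgebraicClosure (v.adicCompletion ℚ)))
    (hΔ : IsUnit W₀.Δ)
    (hu0 : θ ^ (padicValInt p W.minimalDiscriminantInt /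
      Nat.gcd 12 (padicValInt p W.minimalDiscriminantInt)) ≠ 0)
    (Cs : VariableChange ℚ)
    (hC : C = ⟨Units.mk0 _ hu0, 0, 0, 0⟩ *
      Cs.map (algebraMap ℚ (AlgebraicClosure (v.adicCompletion ℚ))))
    (P : (W₀.baseChange (AlgebraicClosure (v.adicCompletion ℚ))).toAffine.Point) (hP : (p : ℤ) • P = 0) :
    goodReductionHom W₀ (Valuation.integer.integers (specVal v)) hΔ P = 0 := by
  by_contra hne
  exact hndvd (semistabilityIndex_dvd_sub_one_of_ordinary W p hp5 hpv hbad hθ hW₀ hΔ hu0 Cs hC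
    ⟨P, hP, hne⟩)

/-- **Class form on the census cell `(t′)` = `SubTprime`** (`¬ PotMult ∧ f_p = 2 ∧ e ∤ p − 1`) of an
additive `p ≥ 5`: the GLOBAL Kummer–Deuring good model of p07's A3
(`exists_kummerGoodModel_global`: `θ ∈ ℚ̄` with `θ^e = p`, `W₀ = C • E ⊗ K̄_v` with unit
discriminant, `C` fixed by every local `σ` fixing `ι θ`) has ALL its `p`-torsion reducing to `Õ`.
This is the kernel certificate behind the O5 typing's sentence "(t′): `e ∤ p − 1` … potentially good
SUPERSINGULAR" (`SubTprime`, `Additive/SharpenedStatements.lean`); the `(t′)` half of Greenberg's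
Thm. 1.7 (row T-CG-SS) additionally needs the `p^k`-torsion statement (module docstring: located
gap). O5 stays OPEN; nothing booked. [cite: Serre1972, §5.6 (p. 312)] [cite: SerreTate1968, §2 Cor. 2] -/
theorem SubTprime.exists_kummerGoodModel_forall_torsion_red_eq_zero (hp5 : 5 ≤ p) (hadd : Addv W p)
    (h : SubTprime W p) (hpv : ((p : ℕ) : 𝓞 ℚ) ∈ v.asIdeal) :
    ∃ (θ : AlgebraicClosure ℚ) (C : VariableChange (AlgebraicClosure (v.adicCompletion ℚ)))
      (W₀ : WeierstrassCurve (specVal v).integer)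
      (_ : C • (W.baseChange (v.adicCompletion ℚ)).baseChange (AlgebraicClosure (v.adicCompletion ℚ)) =
        W₀.baseChange (AlgebraicClosure (v.adicCompletion ℚ)))
      (hΔ : IsUnit W₀.Δ),
      θ ^ semistabilityIndex W p = ((p : ℕ) : AlgebraicClosure ℚ) ∧
      (∀ σ : absoluteGaloisGroup (v.adicCompletion ℚ),
        σ • absClosureEmbedding ℚ (v.adicCompletion ℚ) θ = absClosureEmbedding ℚ (v.adicCompletion ℚ) θ →
        C.map ((absoluteGaloisGroup.toAlgEquiv _ σ :
          AlgebraicClosure (v.adicCompletion ℚ) ≃ₐ[v.adicCompletion ℚ]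
            AlgebraicClosure (v.adicCompletion ℚ)) :
          AlgebraicClosure (v.adicCompletion ℚ) →+* AlgebraicClosure (v.adicCompletion ℚ)) = C) ∧
      ∀ P : (W₀.baseChange (AlgebraicClosure (v.adicCompletion ℚ))).toAffine.Point,
        (p : ℤ) • P = 0 → goodReductionHom W₀ (Valuation.integer.integers (specVal v)) hΔ P = 0 := by
  have hj : 0 ≤ padicValRat p W.j := not_lt.mp h.1
  have hbad : ¬ W.HasGoodReductionAt v := by
    rw [eq_primesEquiv_symm p hpv]
    exact (hasAdditiveReductionAt_of_addv W p hadd).not_hasGoodReductionAt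
  obtain ⟨θ, C, W₀, hθ, hW₀, hΔ, ⟨hu0, Cs, hC⟩, hfix, -⟩ := exists_kummerGoodModel_global p W hp5 hpv hj
  have hθ' : (absClosureEmbedding ℚ (v.adicCompletion ℚ) θ) ^ semistabilityIndex W p =
      ((p : ℕ) : AlgebraicClosure (v.adicCompletion ℚ)) := by
    rw [← map_pow, hθ, map_natCast]
  exact ⟨θ, C, W₀, hW₀, hΔ, hθ, hfix, fun P hP ↦
    forall_torsion_goodReductionHom_eq_zero_of_not_dvd W p hp5 hpv hbad h.2.2 hθ' hW₀ hΔ hu0 Cs hC P hP⟩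

end Summit.BirchSwinnertonDyer.Rank1Residual.Additive.GoodModelLine

end
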